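import Summits.QuantumFields.BalabanUV.T4Continuum.Support.NE7K1LinTorusFineWavesFibre
import Summits.QuantumFields.BalabanUV.T4Continuum.Support.NE7K1LinTorusSymbolWindow

/-!
# NE7K1LinTorusPairing — row NE7 (node U5), candidate route HOM, path H1L, cell K1-lin(s): NEEDS-ESTIMATE #E1, B-E1 — THE
# PAIRING IDENTITY behind lens 2's S-69-1 THEOREM I (`σ₁(p) = n²·k_L(θ(p))`): a fine field with block sums `L^{d+1}χ_p` on
# which the fine operator acts as a multiplier `σ·χ_p∘blk` forces `1 = σ·Σ_k U_L(k;θ)∕m̂_k`; and the fine periodic operator's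
# eigenvalues on the alias fibre, `m̂_k = n²·Δ^ξ_L(θ + 2πk)`

Lineage `b2b-balaban-t4-ne7-p2` (CRUX PROVER NE7 #2), generation 75; file 58 (assembly part 1; part 2 = file 59
`NE7K1LinTorusSymbolBloch`: the KKT field and THEOREM I).  Files 56–57 supplied the Fourier kit on the alias fibre
`q_k = p + P∘k` ((3a) block sums, (3b) `|w_k|² = U_L(k;θ)`, (3c) completeness).  THIS FILE:

* §1 THE ABSTRACT PAIRING IDENTITY **`pairing_identity`**: on a block-union region with fine period `L·P`, a real symmetric
  fine operator `M` whose fibre waves `e_{q_k}` are eigenvectors (`M e_{q_k} = m̂_k e_{q_k}`, `m̂_k ≠ 0` real), a complex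
  fine field `Φ` with `M Φ = σ·χ_p∘blk` and block sums `Σ_{x∈β}Φ = L^{d+1}χ_p(β)` force `1 = σ·Σ_k U_L(k;θ(p))∕m̂_k` — by
  pairing the first equation with `conj e_{q_k}` ((3a)) and the second with `conj χ_p∘blk` ((3c)); `|p_μ| < P_μ`.  This is
  the EXISTENCE side of file 30's KKT system (`kkt_field`), not the uniqueness side — no minimiser, no positivity is used.
* §2 THE FINE PERIODIC OPERATOR ON THE FIBRE WAVES: `dbl_fine_eq` (`P′ = L·P`), `fib_angle`
  (`2π(q_k)_μ∕P′_μ = (θ_μ + 2πk_μ)∕L`), **`torOpK_fibWave`** — `torOpK (nL) 0` has the fibre waves as eigenvectors with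
  eigenvalue `m̂_k = n²·DeltaXir L 0 (shiftr L k θ(p))` (file 37's `sum_mul_chiT_of_transl`, file 40's
  `torOpK_zero_transl_apply ∕ symbT_torOpK_zero_re`, file 38's `symbT_im_eq_zero` BY NAME), and **`DeltaXir_shiftr_pos`**:
  `m̂_k > 0` for every `k` once `p ≠ 0`, `|p_μ| < P_μ` (file 57's `Sxir_fib_eq_zero`).

HONEST FRAMING: [folklore] finite Fourier analysis; an identity and a positivity remark, no estimate; nothing of Bałaban's
asserted; no `sorry`.  Census only (B-E1's identification, assembly part 1); NE7 NOT PRINTED ∕ NOT PROVED; spine 0∕9; FIXED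
FINITE T⁴, rung (B)+1; NOT infinite volume, NOT mass gap, NOT Clay.  HONEST DEPENDENCY: continuum YM on T⁴ ⇐ BetaPertH ∧
nine spine estimates (0/9 proved); BetaPertH ⇐ (D1) ∧ (D4) ∧ CAP+tail; G-an2-4 gates asym, D1 and NE2/3/4.
-/

noncomputable section

open Finset Matrix Complex

namespace Summit.QuantumFields.BalabanUV.T4Continuum.NE7K1LinTorusPairing

open Literature.MathematicalPhysics.QuantumFieldTheory.Balaban1983to89
open Literature.MathematicalPhysics.QuantumFieldTheory.Balaban1983to89.B4Reflection242
open Literature.MathematicalPhysics.QuantumFieldTheory.Balaban1983to89.B4Lower18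
open Literature.MathematicalPhysics.QuantumFieldTheory.Balaban1983to89.B4Green244 (finePt)
open Literature.MathematicalPhysics.QuantumFieldTheory.Balaban1983to89.B4TorusPositivity (wrap)
open Literature.MathematicalPhysics.QuantumFieldTheory.Balaban1983to89.B4Strip (S1r Sxir uFactorr Ur shiftr DeltaXir
  Delta1r Sxir_nonneg)
open NE7K1LinFoldKernels NE7K1LinFoldMatrices NE7K1LinSchurFold NE7K1LinTorusChart NE7K1LinSchurFoldBox NE7K1LinBlockCoords
open NE7K1LinTorusLineSymbol NE7K1LinTorusSymbolReal NE7K1LinTorusFloor NE7K1LinTorusSymbolWindow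
open NE7K1LinTorusFineWaves NE7K1LinTorusFineWavesFibre NE7K1LinSchurLineU1

variable {d : ℕ}

/-! ### §1 The abstract pairing identity -/

section Pairing

variable {L : ℕ} [NeZero L] {Pf Pc : Fin (d + 1) → ℕ} {T : Finset (Fin (d + 1) → ℤ)}

/-- **THE PAIRING IDENTITY.**  Fine period `L·P`, block-union region `T` with at least one block, dual index `p` with
`|p_μ| < P_μ`; a real symmetric `M` on `T` whose fibre waves are eigenvectors with real non-zero eigenvalues `m̂_k`; a complex
field `Φ` with `MΦ = σ·χ_p∘blk` and block sums `L^{d+1}χ_p`.  Then `1 = σ·Σ_k U_L(k; θ(p))∕m̂_k`. [folklore] -/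
theorem pairing_identity (hPf : Pf = fun i => L * Pc i) (hPc : ∀ i, 1 ≤ Pc i) (hTL : IsBlockUnion L T)
    (hT0 : 0 < Fintype.card ↥(T.image (blk L))) {p : Fin (d + 1) → ℤ} (hp : ∀ μ, |p μ| < Pc μ)
    (Mf : Matrix ↥T ↥T ℝ) (hMf : Mf.IsSymm) (mhat : (Fin (d + 1) → Fin L) → ℝ) (hmhat : ∀ k, mhat k ≠ 0)
    (heig : ∀ (k : Fin (d + 1) → Fin L) (x : ↥T),
      ∑ x' : ↥T, (Mf x x' : ℂ) * chiT Pf (fibMom Pc p k) x'.1 = (mhat k : ℂ) * chiT Pf (fibMom Pc p k) x.1)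
    (Φ : ↥T → ℂ) (σr : ℝ)
    (hMΦ : ∀ x : ↥T, ∑ x' : ↥T, (Mf x x' : ℂ) * Φ x' = (σr : ℂ) * chiT Pc p (rblk L T x).1)
    (hSΦ : ∀ β : ↥(T.image (blk L)),
      ∑ j : Fin (d + 1) → Fin L, Φ (rchart NeZero.one_le hTL β j) = (L : ℂ) ^ (d + 1) * chiT Pc p β.1) :
    (1 : ℝ) = σr * ∑ k : Fin (d + 1) → Fin L, Ur L k (thetaOf Pc p) / mhat k := by
  classical
  have hℓ0 : ((L : ℂ) ^ (d + 1)) ≠ 0 := pow_ne_zero _ (by exact_mod_cast NeZero.ne L)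
  have hNc0 : (Fintype.card ↥(T.image (blk L)) : ℂ) ≠ 0 := by exact_mod_cast hT0.ne'
  set ℓ : ℂ := (L : ℂ) ^ (d + 1) with hℓ
  set Nc : ℂ := (Fintype.card ↥(T.image (blk L)) : ℂ) with hNc
  set Φh : (Fin (d + 1) → Fin L) → ℂ := fun k => ∑ x : ↥T, starRingEnd ℂ (chiT Pf (fibMom Pc p k) x.1) * Φ x with hΦh
  have hw : ∀ k : Fin (d + 1) → Fin L,
      ∑ j : Fin (d + 1) → Fin L, chiT Pf (fibMom Pc p k) (kvec j) = ℓ * wMean L Pc p k := by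
    intro k
    rw [wMean, ← hPf, ← mul_assoc, mul_inv_cancel₀ hℓ0, one_mul]
  -- (E_k): pair `MΦ = σ·χ_p∘blk` with `conj e_{q_k}`
  have hE : ∀ k : Fin (d + 1) → Fin L, (mhat k : ℂ) * Φh k = (σr : ℂ) * ℓ * Nc * starRingEnd ℂ (wMean L Pc p k) := by
    intro k
    have way1 : ∑ x : ↥T, starRingEnd ℂ (chiT Pf (fibMom Pc p k) x.1) * (∑ x' : ↥T, (Mf x x' : ℂ) * Φ x') =
        (σr : ℂ) * ℓ * Nc * starRingEnd ℂ (wMean L Pc p k) := by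
      simp_rw [hMΦ]
      rw [sum_eq_sum_blocks_complex hTL]
      have e1 : ∀ (β : ↥(T.image (blk L))) (j : Fin (d + 1) → Fin L),
          starRingEnd ℂ (chiT Pf (fibMom Pc p k) (rchart NeZero.one_le hTL β j).1) *
              ((σr : ℂ) * chiT Pc p (rblk L T (rchart NeZero.one_le hTL β j)).1) =
            (σr : ℂ) * starRingEnd ℂ (chiT Pf (fibMom Pc p k) (kvec j)) := by
        intro β j
        rw [rblk_rchart, show (rchart NeZero.one_le hTL β j).1 = finePt L β.1 j from rfl, chiT_fib_finePt hPf hPc,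
          map_mul]
        have h1 := chiT_mul_conj Pc p β.1
        linear_combination (σr : ℂ) * starRingEnd ℂ (chiT Pf (fibMom Pc p k) (kvec j)) * h1
      simp_rw [e1]
      rw [Finset.sum_const, Finset.card_univ, nsmul_eq_mul, ← Finset.mul_sum, ← map_sum, hw k, map_mul, map_pow,
        map_natCast]
      ring
    have way2 : ∑ x : ↥T, starRingEnd ℂ (chiT Pf (fibMom Pc p k) x.1) * (∑ x' : ↥T, (Mf x x' : ℂ) * Φ x') =
        (mhat k : ℂ) * Φh k := by
      calc ∑ x : ↥T, starRingEnd ℂ (chiT Pf (fibMom Pc p k) x.1) * (∑ x' : ↥T, (Mf x x' : ℂ) * Φ x')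
          = ∑ x : ↥T, ∑ x' : ↥T, starRingEnd ℂ (chiT Pf (fibMom Pc p k) x.1) * ((Mf x x' : ℂ) * Φ x') := by
            simp_rw [Finset.mul_sum]
        _ = ∑ x' : ↥T, ∑ x : ↥T, starRingEnd ℂ (chiT Pf (fibMom Pc p k) x.1) * ((Mf x x' : ℂ) * Φ x') :=
            Finset.sum_comm
        _ = ∑ x' : ↥T, Φ x' * (∑ x : ↥T, (Mf x' x : ℂ) * starRingEnd ℂ (chiT Pf (fibMom Pc p k) x.1)) := by
            refine Finset.sum_congr rfl fun x' _ => ?_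
            rw [Finset.mul_sum]
            refine Finset.sum_congr rfl fun x _ => ?_
            rw [hMf.apply x x']
            ring
        _ = ∑ x' : ↥T, Φ x' * ((mhat k : ℂ) * starRingEnd ℂ (chiT Pf (fibMom Pc p k) x'.1)) := by
            refine Finset.sum_congr rfl fun x' _ => ?_
            congr 1
            have h := congrArg (starRingEnd ℂ) (heig k x')
            rw [map_sum, map_mul, Complex.conj_ofReal] at h
            simp_rw [map_mul, Complex.conj_ofReal] at h
            exact h
        _ = (mhat k : ℂ) * Φh k := by
            rw [hΦh, Finset.mul_sum]
            exact Finset.sum_congr rfl fun x' _ => by ring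
    rw [← way2, way1]
  -- (F): pair the block sums with `conj χ_p∘blk`
  have hF : ∑ k : Fin (d + 1) → Fin L, wMean L Pc p k * Φh k = ℓ * Nc := by
    have way1 : ∑ x : ↥T, starRingEnd ℂ (chiT Pc p (rblk L T x).1) * Φ x = ℓ * Nc := by
      rw [sum_eq_sum_blocks_complex hTL]
      simp_rw [rblk_rchart, ← Finset.mul_sum, hSΦ]
      have e2 : ∀ β : ↥(T.image (blk L)), starRingEnd ℂ (chiT Pc p β.1) * (ℓ * chiT Pc p β.1) = ℓ := by
        intro β
        have h1 := chiT_mul_conj Pc p β.1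
        linear_combination ℓ * h1
      simp_rw [e2]
      rw [Finset.sum_const, Finset.card_univ, nsmul_eq_mul, mul_comm]
    have way2 : ∑ x : ↥T, starRingEnd ℂ (chiT Pc p (rblk L T x).1) * Φ x =
        ∑ β : ↥(T.image (blk L)), ∑ j : Fin (d + 1) → Fin L, ∑ k : Fin (d + 1) → Fin L, wMean L Pc p k *
          (starRingEnd ℂ (chiT Pf (fibMom Pc p k) (rchart NeZero.one_le hTL β j).1) *
            Φ (rchart NeZero.one_le hTL β j)) := by
      rw [sum_eq_sum_blocks_complex hTL]
      refine Finset.sum_congr rfl fun β _ => Finset.sum_congr rfl fun j _ => ?_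
      have e3 : starRingEnd ℂ (chiT Pc p β.1) = ∑ k : Fin (d + 1) → Fin L, wMean L Pc p k *
            starRingEnd ℂ (chiT Pf (fibMom Pc p k) (rchart NeZero.one_le hTL β j).1) := by
        rw [← sum_conj_wMean_mul_fibWave_rchart hPf hPc hTL p β j, map_sum]
        refine Finset.sum_congr rfl fun k _ => ?_
        rw [map_mul, starRingEnd_self_apply]
      rw [rblk_rchart, e3, Finset.sum_mul]
      exact Finset.sum_congr rfl fun k _ => by ring
    have way3 : ∑ k : Fin (d + 1) → Fin L, wMean L Pc p k * Φh k =
        ∑ β : ↥(T.image (blk L)), ∑ j : Fin (d + 1) → Fin L, ∑ k : Fin (d + 1) → Fin L, wMean L Pc p k *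
          (starRingEnd ℂ (chiT Pf (fibMom Pc p k) (rchart NeZero.one_le hTL β j).1) *
            Φ (rchart NeZero.one_le hTL β j)) := by
      rw [← sum_eq_sum_blocks_complex hTL (fun x => ∑ k : Fin (d + 1) → Fin L, wMean L Pc p k *
          (starRingEnd ℂ (chiT Pf (fibMom Pc p k) x.1) * Φ x)), Finset.sum_comm]
      refine Finset.sum_congr rfl fun k _ => ?_
      rw [hΦh]
      simp only
      rw [Finset.mul_sum]
    rw [way3, ← way2, way1]
  -- solve (E_k) for `Φ̂_k` and substitute into (F)
  have hΦsol : ∀ k : Fin (d + 1) → Fin L,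
      wMean L Pc p k * Φh k = ℓ * Nc * ((σr : ℂ) * (((Ur L k (thetaOf Pc p) : ℝ) : ℂ) / (mhat k : ℂ))) := by
    intro k
    have hm : (mhat k : ℂ) ≠ 0 := by exact_mod_cast hmhat k
    have h1 : Φh k = (σr : ℂ) * ℓ * Nc * starRingEnd ℂ (wMean L Pc p k) / (mhat k : ℂ) := by
      rw [eq_div_iff hm, mul_comm, hE k]
    rw [h1, ← mul_div_assoc, show wMean L Pc p k * ((σr : ℂ) * ℓ * Nc * starRingEnd ℂ (wMean L Pc p k)) =
      (σr : ℂ) * ℓ * Nc * (wMean L Pc p k * starRingEnd ℂ (wMean L Pc p k)) by ring, wMean_mul_conj hPc hp k]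
    field_simp
  simp_rw [hΦsol] at hF
  rw [← Finset.mul_sum, ← Finset.mul_sum] at hF
  have h1 : (σr : ℂ) * ∑ k : Fin (d + 1) → Fin L, (((Ur L k (thetaOf Pc p) : ℝ) : ℂ) / (mhat k : ℂ)) = 1 := by
    have h2 : ℓ * Nc * ((σr : ℂ) * ∑ k : Fin (d + 1) → Fin L, (((Ur L k (thetaOf Pc p) : ℝ) : ℂ) / (mhat k : ℂ))) =
        ℓ * Nc * 1 := by rw [mul_one]; exact hF
    exact mul_left_cancel₀ (mul_ne_zero hℓ0 hNc0) h2
  have h3 : (((σr * ∑ k : Fin (d + 1) → Fin L, Ur L k (thetaOf Pc p) / mhat k : ℝ)) : ℂ) = ((1 : ℝ) : ℂ) := by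
    push_cast
    exact h1
  exact (Complex.ofReal_inj.1 h3).symm

end Pairing

/-! ### §2 The fine periodic operator on the fibre waves -/

section FineOp

variable {n L : ℕ} [NeZero L] {M : Fin (d + 1) → ℕ}

omit [NeZero L] in
/-- `P′ = L·P`: the fine doubled period is `L` times the coarse one. [folklore] -/
theorem dbl_fine_eq (n L : ℕ) (M : Fin (d + 1) → ℕ) :
    dbl (fun i => n * L * M i) = fun i => L * dbl (fun i => n * M i) i := by
  funext i; simp only [dbl_apply]; ring

omit [NeZero L] in
/-- positivity of the fine sides. [folklore] -/
theorem fine_pos (hn : 1 ≤ n) (hL : 1 ≤ L) (hM : ∀ i, 1 ≤ M i) : ∀ i, 1 ≤ (fun i => n * L * M i) i :=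
  mul_pos_side (NE7K1LinSchurFoldBox.one_le_mul hn hL) hM

/-- THE FIBRE ANGLE: `2π·(q_k)_μ∕P′_μ = (θ(p)_μ + 2πk_μ)∕L`. [folklore] -/
theorem fib_angle (hn : 1 ≤ n) (hM : ∀ i, 1 ≤ M i) (p : Fin (d + 1) → ℤ) (k : Fin (d + 1) → Fin L)
    (μ : Fin (d + 1)) :
    2 * Real.pi * (fibMom (dbl fun i => n * M i) p k μ : ℝ) / (dbl (fun i => n * L * M i) μ : ℝ) =
      shiftr L k (thetaOf (dbl fun i => n * M i) p) μ / L := by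
  have hP0 : ((dbl (fun i => n * M i) μ : ℕ) : ℝ) ≠ 0 := by
    exact_mod_cast (show dbl (fun i => n * M i) μ ≠ 0 by have := dbl_pos (mul_pos_side hn hM) μ; omega)
  have hL0 : (L : ℝ) ≠ 0 := by exact_mod_cast NeZero.ne L
  have hden : ((dbl (fun i => n * L * M i) μ : ℕ) : ℝ) = L * ((dbl (fun i => n * M i) μ : ℕ) : ℝ) := by
    simp only [dbl_apply]; push_cast; ring
  rw [hden]
  simp only [shiftr, thetaOf, fibMom, kvec, Pi.add_apply]
  push_cast
  field_simp

/-- **THE FIBRE WAVES ARE EIGENVECTORS OF THE FINE PERIODIC OPERATOR at `a = 0`** with eigenvalue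
`m̂_k = n²·Δ^ξ_L(θ(p) + 2πk)` (`(nL)²Σ_μ(2 − 2cos(2π(q_k)_μ∕P′_μ))`, files 37∕38∕40 BY NAME). [folklore] -/
theorem torOpK_fibWave (hn : 1 ≤ n) (hM : ∀ i, 1 ≤ M i) (p : Fin (d + 1) → ℤ) (k : Fin (d + 1) → Fin L)
    (x : ↥(boxDom (dbl fun i => n * L * M i))) :
    ∑ x' : ↥(boxDom (dbl fun i => n * L * M i)),
        ((torOpK (n * L) 0 (fun i => n * L * M i) (boxDom (dbl fun i => n * L * M i)) x x' : ℝ) : ℂ) *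
          chiT (dbl fun i => n * L * M i) (fibMom (dbl fun i => n * M i) p k) x'.1 =
      (((n : ℝ) ^ 2 * DeltaXir L 0 (shiftr L k (thetaOf (dbl fun i => n * M i) p)) : ℝ) : ℂ) *
        chiT (dbl fun i => n * L * M i) (fibMom (dbl fun i => n * M i) p k) x.1 := by
  have hL : 1 ≤ L := NeZero.one_le
  have hN : ∀ i, 1 ≤ (fun i => n * L * M i) i := fine_pos hn hL hM
  rw [sum_mul_chiT_of_transl (dbl_pos hN) _ (fun v x' y' => torOpK_zero_transl_apply (n * L) hN v x' y') x x _]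
  congr 1
  apply Complex.ext
  · rw [symbT_torOpK_zero_re (n * L) hN x _, Complex.ofReal_re, DeltaXir, add_zero, Finset.mul_sum, Finset.mul_sum]
    refine Finset.sum_congr rfl fun μ _ => ?_
    rw [fib_angle hn hM p k μ, Sxir]
    push_cast
    ring
  · rw [symbT_im_eq_zero (dbl_pos hN) _ (torOpK_isSymm (n * L) 0 _ rfl)
      (fun v x' y' => torOpK_zero_transl_apply (n * L) hN v x' y') x _, Complex.ofReal_im]

/-- **`m̂_k > 0` away from the zero mode**: for `p ≠ 0` with `|p_μ| < P_μ`, `Δ^ξ_L(θ(p) + 2πk) > 0` for EVERY `k`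
(`Sxir_fib_eq_zero`). [folklore] -/
theorem DeltaXir_shiftr_pos {Pc : Fin (d + 1) → ℕ} (hPc : ∀ i, 1 ≤ Pc i) {p : Fin (d + 1) → ℤ}
    (hp : ∀ μ, |p μ| < Pc μ) (hp0 : p ≠ 0) (k : Fin (d + 1) → Fin L) :
    0 < DeltaXir L 0 (shiftr L k (thetaOf Pc p)) := by
  have hL : 1 ≤ L := NeZero.one_le
  obtain ⟨μ, hμ⟩ := Function.ne_iff.1 hp0
  rw [DeltaXir, add_zero]
  have hle : Sxir L (shiftr L k (thetaOf Pc p) μ) ≤ ∑ ν, Sxir L (shiftr L k (thetaOf Pc p) ν) :=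
    Finset.single_le_sum (fun ν _ => Sxir_nonneg L _) (Finset.mem_univ μ)
  have hpos : 0 < Sxir L (shiftr L k (thetaOf Pc p) μ) := by
    rcases (Sxir_nonneg L (shiftr L k (thetaOf Pc p) μ)).lt_or_eq with h | h
    · exact h
    · exfalso
      have h' : Sxir L (thetaOf Pc p μ + 2 * Real.pi * ((k μ : ℕ) : ℝ)) = 0 := h.symm
      exact hμ (Sxir_fib_eq_zero hL hPc μ (hp μ) k h').1
  linarith

end FineOp

end Summit.QuantumFields.BalabanUV.T4Continuum.NE7K1LinTorusPairing

end
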